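import Summits.Ventures.YMGap.RobustBall.RobustSlabSteps
import HarnessLib

/-!
# Robust ball (Y2), area-law side, part 2d — where the hypotheses (HCentre) and (HLoc) come from

HONEST FRAMING: venture file of the cell `pub-ymgap` (QuantumFields programme), track ROBUST-BALL.  Two elementary SUFFICIENT CONDITIONS
for the hypotheses of the robust Durhuus–Fröhlich criterion (`RobustSlabCriterion`), so that members of the ball get them from their
defining data (gauge-invariant local activities of bounded vertical dependence):
* (HLoc) `hasVerticalRange_finset_sum`: a finite sum `W = Σ_i F_i` of terms each depending, among the `v`-directed links, only on those at
  `m` consecutive `v`-heights (`DependsOn (F i) {e | e.2 ≠ v ∨ ∃ k < m, e.1 v = t₀ + k}` — the shape of rb-theory's `IsSlabLocal.vert_range`)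
  has vertical range `m` seen by the `v`-slabs: `HasVerticalRange W v m`.
* (HCentre) `apply_slabRotate_eq_of_isGaugeInvariant`: a GAUGE-INVARIANT function depending only on a link set `S` that misses the
  `v`-links of SOME height `s ≠ t` is invariant under the centre rotation of the `v`-links at height `t` (the rotation agrees on `S` with
  the gauge transformation `g = z` on the band of heights `t+1, …, s`, `g = 1` elsewhere).  Polyakov-loop terms (which see every height)
  are exactly what this does not cover; on a torus with `L ≤ m` nothing is claimed.
Finite-torus bookkeeping only; no area law / continuum / mass-gap claim in this file.
-/

noncomputable section

open MeasureTheory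
open Literature.MathematicalPhysics.QuantumLattice (fundamentalRep continuous_fundamentalRep fundamentalRep_apply)
open Literature.MathematicalPhysics.QuantumFieldTheory
open Literature.MathematicalPhysics.QuantumFieldTheory.DurhuusFrohlich

namespace Summit.Ventures.YMGap.RobustBall

variable {n L N : ℕ}

/-! ### (HLoc) from bounded vertical dependence of the terms -/

section Range

variable [NeZero L]

omit [NeZero L] in
/-- A term depending, among the `v`-links, only on those at the heights `t₀, …, t₀+m-1` does not distinguish two glued configurations
whose rests agree on the window of range `m` around a slab INSIDE that height range. [folklore] -/
theorem apply_glue_eq_of_dependsOn_window {F : GaugeConfig (n + 1) L (SU N) → ℝ} {v : Fin (n + 1)} {t₀ : ZMod L} {m : ℕ}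
    (hF : DependsOn F {e : Edge (n + 1) L | e.2 ≠ v ∨ ∃ k : ℕ, k < m ∧ e.1 v = t₀ + k}) {k₀ : ℕ} (hk₀ : k₀ < m)
    (Q : Site n L → SU N) (r r' : {e : Edge (n + 1) L // ¬ IsSlab v (t₀ + (k₀ : ZMod L)) e} → SU N)
    (h : ∀ e, InWindow v (t₀ + (k₀ : ZMod L)) m e.1 → r e = r' e) :
    F (glue v (t₀ + (k₀ : ZMod L)) Q r) = F (glue v (t₀ + (k₀ : ZMod L)) Q r') := by
  refine hF fun e he => ?_
  by_cases hs : IsSlab v (t₀ + (k₀ : ZMod L)) e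
  · simp only [glue_of_isSlab _ _ _ _ hs]
  · simp only [glue_of_not_isSlab _ _ _ _ hs]
    refine h ⟨e, hs⟩ ?_
    rcases he with hne | ⟨k, hk, hke⟩
    · exact Or.inl hne
    · refine Or.inr ?_
      by_cases hkk : k₀ ≤ k
      · refine ⟨k - k₀, by omega, Or.inl ?_⟩
        rw [hke, add_assoc, ← Nat.cast_add, Nat.add_sub_cancel' hkk]
      · refine ⟨k₀ - k, by omega, Or.inr ?_⟩
        rw [hke, add_assoc, ← Nat.cast_add, Nat.add_sub_cancel' (by omega : k ≤ k₀)]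

omit [NeZero L] in
/-- A term depending, among the `v`-links, only on those at the heights `t₀, …, t₀+m-1` does not see the slab at a height OUTSIDE
that range. [folklore] -/
theorem apply_glue_eq_of_dependsOn_outside {F : GaugeConfig (n + 1) L (SU N) → ℝ} {v : Fin (n + 1)} {t₀ : ZMod L} {m : ℕ}
    (hF : DependsOn F {e : Edge (n + 1) L | e.2 ≠ v ∨ ∃ k : ℕ, k < m ∧ e.1 v = t₀ + k}) {t : ZMod L}
    (ht : ¬ ∃ k : ℕ, k < m ∧ t = t₀ + k) (Q Q' : Site n L → SU N) (r : {e : Edge (n + 1) L // ¬ IsSlab v t e} → SU N) :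
    F (glue v t Q r) = F (glue v t Q' r) := by
  refine hF fun e he => ?_
  have hs : ¬ IsSlab v t e := by
    rintro ⟨hv, hh⟩
    rcases he with hne | ⟨k, hk, hke⟩
    · exact hne hv
    · exact ht ⟨k, hk, by rw [← hh, hke]⟩
  simp only [glue_of_not_isSlab _ _ _ _ hs]

omit [NeZero L] in
/-- **(HLoc) from bounded vertical dependence.**  A finite sum of terms, each depending among the `v`-directed links only on those
at `m` consecutive `v`-heights, has vertical range `m` seen by the `v`-slabs. [folklore] -/
theorem hasVerticalRange_finset_sum {ι : Type*} (s : Finset ι) (F : ι → GaugeConfig (n + 1) L (SU N) → ℝ)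
    (v : Fin (n + 1)) (m : ℕ)
    (hF : ∀ i ∈ s, ∃ t₀ : ZMod L, DependsOn (F i) {e : Edge (n + 1) L | e.2 ≠ v ∨ ∃ k : ℕ, k < m ∧ e.1 v = t₀ + k}) :
    HasVerticalRange (fun U => ∑ i ∈ s, F i U) v m := by
  intro t Q r r' h
  simp only [← Finset.sum_sub_distrib]
  refine Finset.sum_congr rfl fun i hi => ?_
  obtain ⟨t₀, hFi⟩ := hF i hi
  by_cases ht : ∃ k : ℕ, k < m ∧ t = t₀ + k
  · obtain ⟨k₀, hk₀, rfl⟩ := ht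
    rw [apply_glue_eq_of_dependsOn_window hFi hk₀ Q r r' h,
      apply_glue_eq_of_dependsOn_window hFi hk₀ (fun _ => 1) r r' h, sub_self, sub_self]
  · rw [apply_glue_eq_of_dependsOn_outside hFi ht Q (fun _ => 1) r,
      apply_glue_eq_of_dependsOn_outside hFi ht Q (fun _ => 1) r']

end Range

/-! ### (HCentre) from gauge invariance -/

section CentreFromGauge

variable [NeZero L]

open Classical in
/-- The band gauge transformation: `z` on the sites at heights `t+1, …, t+h`, `1` elsewhere. [folklore] -/
def bandGauge (v : Fin (n + 1)) (t : ZMod L) (h : ℕ) (z : SU N) (y : Site (n + 1) L) : SU N :=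
  if ∃ k : ℕ, 1 ≤ k ∧ k ≤ h ∧ y v = t + k then z else 1

/-- **The band gauge transformation is the pair of centre rotations**: for central `z`, `s = t + h` with `1 ≤ h < L`, the gauge
transformation by `bandGauge v t h z` multiplies the `v`-links at height `t` by `z⁻¹`, those at height `s` by `z`, and fixes all others;
in particular it agrees with `slabRotate z⁻¹ v t` on every link that is not a `v`-link at height `s`. [folklore] -/
theorem gaugeTransform_bandGauge_apply (v : Fin (n + 1)) (t : ZMod L) {h : ℕ} (h1 : 1 ≤ h) (hL : h < L) {z : SU N}
    (hz : z ∈ Subgroup.center (SU N)) (U : GaugeConfig (n + 1) L (SU N)) (e : Edge (n + 1) L)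
    (hs : ¬ IsSlab v (t + (h : ZMod L)) e) :
    gaugeTransform (bandGauge v t h z) U e = slabRotate z⁻¹ v t U e := by
  classical
  have hzc : ∀ g : SU N, g * z = z * g := fun g => (Subgroup.mem_center_iff.1 hz g)
  have hzc' : ∀ g : SU N, g * z⁻¹ = z⁻¹ * g := fun g => Subgroup.mem_center_iff.1 (inv_mem hz) g
  obtain ⟨y, k'⟩ := e
  -- membership in the band, as a function of the height
  set inB : ZMod L → Prop := fun a => ∃ k : ℕ, 1 ≤ k ∧ k ≤ h ∧ a = t + k with hinB
  have hg : ∀ w : Site (n + 1) L, bandGauge v t h z w = if inB (w v) then z else 1 := fun w => rfl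
  simp only [gaugeTransform, slabRotate, hg]
  by_cases hk' : k' = v
  · subst k'
    have hshift : (y.shift v) v = y v + 1 := by simp [Site.shift]
    rw [hshift]
    -- `t` is not in the band; `t + (k+1)` stays in the band unless `k = h`
    have ht_not : ¬ inB t := by
      rintro ⟨k, hk1, hkh, hk⟩
      have : ((k : ℕ) : ZMod L) = ((0 : ℕ) : ZMod L) := by
        have := hk; rw [Nat.cast_zero]; exact (add_left_cancel (this.symm.trans (add_zero t).symm))
      have := Literature.MathematicalPhysics.QuantumLattice.nat_eq_of_zmod_cast_eq (lt_of_le_of_lt hkh hL) (Nat.pos_of_ne_zero (NeZero.ne L)) this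
      omega
    by_cases hst : IsSlab v t (y, v)
    · -- height `t`: multiplied by `z⁻¹`
      have hyt : y v = t := hst.2
      have hb1 : inB (y v + 1) := ⟨1, le_rfl, h1, by rw [hyt, Nat.cast_one]⟩
      have hb0 : ¬ inB (y v) := by rw [hyt]; exact ht_not
      rw [if_neg hb0, if_pos hb1, if_pos hst, one_mul, hzc']
    · rw [if_neg hst]
      have hyt : y v ≠ t := fun hyt => hst ⟨rfl, hyt⟩
      have hys : y v ≠ t + (h : ZMod L) := fun hys => hs ⟨rfl, hys⟩
      -- in the band at `y v` iff in the band at `y v + 1`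
      have hiff : inB (y v) ↔ inB (y v + 1) := by
        constructor
        · rintro ⟨k, hk1, hkh, hk⟩
          have hkh' : k ≠ h := fun hkh' => hys (by rw [hk, hkh'])
          exact ⟨k + 1, by omega, by omega, by rw [hk, add_assoc, ← Nat.cast_succ]⟩
        · rintro ⟨k, hk1, hkh, hk⟩
          have hk1' : k ≠ 1 := by
            rintro rfl
            exact hyt (by simpa using hk)
          refine ⟨k - 1, by omega, by omega, ?_⟩
          have : ((k : ℕ) : ZMod L) = ((k - 1 : ℕ) : ZMod L) + 1 := by
            rw [← Nat.cast_succ, Nat.succ_eq_add_one, Nat.sub_add_cancel hk1]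
          rw [this, ← add_assoc] at hk
          exact add_right_cancel hk
      by_cases hb : inB (y v)
      · rw [if_pos hb, if_pos (hiff.1 hb), ← hzc, mul_assoc, mul_inv_cancel, mul_one]
      · rw [if_neg hb, if_neg (fun hb' => hb (hiff.2 hb')), one_mul, inv_one, mul_one]
  · -- horizontal link: both endpoints at the same height
    have hshift : (y.shift k') v = y v := by
      simp [Site.shift, Ne.symm hk']
    rw [hshift, if_neg (fun hst : IsSlab v t (y, k') => hk' hst.1)]
    by_cases hb : inB (y v)
    · rw [if_pos hb, ← hzc, mul_assoc, mul_inv_cancel, mul_one]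
    · rw [if_neg hb, one_mul, inv_one, mul_one]

/-- **(HCentre) from gauge invariance.**  A gauge-invariant function of the links which depends only on a link set `S` missing the
`v`-links of some height `s ≠ t` is invariant under the centre rotation of the `v`-links at height `t` (any central `z`).  For a term of
vertical dependence diameter `m` on a torus with `L ≥ m + 1` such an `s` always exists; Polyakov-type terms (`m = L`) are not covered.
[folklore] -/
theorem apply_slabRotate_eq_of_isGaugeInvariant {F : GaugeConfig (n + 1) L (SU N) → ℝ} (hF : IsGaugeInvariant F)
    {S : Set (Edge (n + 1) L)} (hS : DependsOn F S) (v : Fin (n + 1)) (t : ZMod L)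
    (hs : ∃ s : ZMod L, s ≠ t ∧ ∀ e ∈ S, ¬ IsSlab v s e) {z : SU N} (hz : z ∈ Subgroup.center (SU N))
    (U : GaugeConfig (n + 1) L (SU N)) : F (slabRotate z v t U) = F U := by
  -- it suffices to treat `z⁻¹` for every central `z`
  suffices key : ∀ {w : SU N}, w ∈ Subgroup.center (SU N) → ∀ U, F (slabRotate w⁻¹ v t U) = F U by
    have := key (inv_mem hz) U; rwa [inv_inv] at this
  intro w hw U
  obtain ⟨s, hst, hS'⟩ := hs
  -- the band height: `s = t + h`, `1 ≤ h < L`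
  set h : ℕ := (s - t).val with hh
  have hL : h < L := ZMod.val_lt _
  have hsth : s = t + (h : ZMod L) := by rw [hh, ZMod.natCast_zmod_val]; ring
  have h1 : 1 ≤ h := by
    rcases Nat.eq_zero_or_pos h with h0 | h0
    · exfalso; apply hst
      have : s - t = 0 := by rw [← ZMod.natCast_zmod_val (s - t), ← hh, h0, Nat.cast_zero]
      exact sub_eq_zero.1 this
    · exact h0
  calc F (slabRotate w⁻¹ v t U) = F (gaugeTransform (bandGauge v t h w) U) := by
        refine hS fun e he => ?_
        rw [gaugeTransform_bandGauge_apply v t h1 hL hw U e (hsth ▸ hS' e he)]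
    _ = F U := hF _ U

/-- The central element `e^{2πi/N}·I` of `SU(N)` lies in the centre. [folklore] -/
theorem centre_mem_center (hN : N ≠ 0) : centre N hN ∈ Subgroup.center (SU N) := by
  rw [Subgroup.mem_center_iff]
  intro g
  apply Subtype.ext
  show (g : Matrix (Fin N) (Fin N) ℂ) * (centre N hN : Matrix (Fin N) (Fin N) ℂ) =
    (centre N hN : Matrix (Fin N) (Fin N) ℂ) * (g : Matrix (Fin N) (Fin N) ℂ)
  rw [coe_centre', Matrix.mul_smul, Matrix.smul_mul, mul_one, one_mul]

end CentreFromGauge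

end Summit.Ventures.YMGap.RobustBall
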